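import Mathlib.Analysis.SpecialFunctions.Pow.Continuity
import Literature.Barriers.MatrixMultiplication.UniversalMethodBarrierCor28
import HarnessLib

/-!
# Alman 2021, Theorem 2.7 — proved (`Alman2021_thm27_holds`)

Topic `Literature/Barriers/MatrixMultiplication`; DISCHARGE of the named fact `Alman2021_thm27` of
the catalogue file `UniversalMethodBarrier.lean`: for every tensor `T` with finite index types over
any field, `R̃(T)^{6/ω_u(T) − 2} ≤ S̃(T)` [Alman 2021, Thm. 2.7, p. 13: "For any tensor `T`,
`S̃(T) ≥ R̃(T)^{6/ω_u(T) − 2}`"; the printed proof is by reference: "This can be formalized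
identically to [AVW18, Theorem 4.1 and Corollary 4.3]"]. Sorry-free.

## Proof

The mechanism (type classes of powers of a qualifying degeneration, three flattenings, slice rank of
`F ⊙ ⟨P,Q,R⟩`, `N → ∞`) is the tree's `asymptoticRank_le_of_qualifying`
(`UniversalMethodBarrierCor28.lean`): for every *qualifying* `w ∈ [2,3]` (i.e. `R̃(T) ≤ V_{w/3}(T)`)
one has `R̃(T) ≤ S̃(T)^{w/6} · R̃(T)^{w/3}`. This file only assembles the statement as printed:

* `R̃(T) > 0`, qualifying `w`: dividing by `R̃^{w/3}` and raising to the power `6/w` gives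
  `R̃^{6/w − 2} ≤ S̃` (`rpow_le_asymptoticSliceRank_of_qualifying`);
* `ω_u(T) = sInf (Q ∪ {3})` (`Q` the qualifying set): if `ω_u(T) = 3` the exponent is `0` and
  `R̃^0 = 1 ≤ S̃(T)` (`T ≠ 0`); if `ω_u(T) < 3` then `ω_u(T) ∈ closure Q` (`csInf_mem_closure`) and
  `w ↦ R̃^{6/w − 2}` is continuous at `ω_u(T) ≥ 2`, so the bound passes to the limit (`le_of_tendsto`);
* `R̃(T) = 0` (only for `T = 0`): `V_τ(T) ≥ 0` always (`degenerationValue_nonneg`), so `w = 2`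
  qualifies, `ω_u(T) = 2`, the exponent is `1` and `0^1 = 0 ≤ S̃(T)`.

## Content

* `degenerationValue_nonneg`, `universalOmega_le_of_qualifying`,
  `universalOmega_eq_two_of_asymptoticRank_eq_zero`, `rpow_le_asymptoticSliceRank_of_qualifying`
  (Thm. 2.7 per qualifying `w`, exponent form), `Alman2021_thm27_holds`.

## References

* J. Alman, *Limits on the Universal Method for Matrix Multiplication*, Theory of Computing 17
  (2021), art. 1, Thm. 2.7 (p. 13), §2.5 (p. 11). [Alman2021]
* J. Alman, V. Vassilevska Williams, FOCS 2018, Thm. 4.1 / Cor. 4.3 (mechanism, cited through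
  [Alman2021]).
-/

noncomputable section

open scoped BigOperators

namespace Literature.Barriers.MatrixMultiplication

open Literature.Computability.AlgebraicComplexity
open Filter _root_.Topology

/-! ## `V_τ ≥ 0` and qualifying exponents -/

section Qualifying

variable (K : Type) [Field K] {ι κ μ : Type} [Fintype ι] [Fintype κ] [Fintype μ]

/-- **`V_τ(T) ≥ 0`**: the set defining `V_τ(T)` contains `0` (the empty direct sum, `n = 1`), so its
supremum is `≥ 0` when the set is bounded above, and is the junk value `Real.sSup = 0` otherwise.
[cite: Alman2021, §2.5] -/
theorem degenerationValue_nonneg (τ : ℝ) (t : ι → κ → μ → K) : 0 ≤ degenerationValue K τ t := by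
  unfold degenerationValue
  set 𝒮 := {v : ℝ | ∃ n : ℕ, 0 < n ∧ ∃ (m : ℕ) (a b c : Fin m → ℕ),
      (∀ i, 0 < a i ∧ 0 < b i ∧ 0 < c i) ∧
        PolyDegeneratesTo (kroneckerPow t n) (matMulDirectSum K a b c) ∧
          v = (∑ i, ((a i * b i * c i : ℕ) : ℝ) ^ τ) ^ (1 / (n : ℝ))} with h𝒮
  by_cases hb : BddAbove 𝒮
  · exact le_csSup hb (zero_mem_degenerationValue_set K τ t)
  · rw [Real.sSup_of_not_bddAbove hb]

/-- A qualifying `w ∈ [2,3]` (`R̃(T) ≤ V_{w/3}(T)`) bounds `ω_u(T)` from above (`ω_u` is the infimum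
of the qualifying set with `3` adjoined). [cite: Alman2021, §2.5] -/
theorem universalOmega_le_of_qualifying (t : ι → κ → μ → K) {w : ℝ} (hw : w ∈ Set.Icc (2 : ℝ) 3)
    (hq : asymptoticRank t ≤ degenerationValue K (w / 3) t) : universalOmega K t ≤ w := by
  refine csInf_le ⟨2, ?_⟩ (Set.mem_union_left _ ⟨hw, hq⟩)
  rintro x (⟨⟨hx, _⟩, _⟩ | hx)
  · exact hx
  · rw [Set.mem_singleton_iff.1 hx]; norm_num

/-- If `R̃(T) = 0` (which happens only for `T = 0`) then `w = 2` qualifies (`V_{2/3}(T) ≥ 0`) and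
`ω_u(T) = 2`. [folklore] -/
theorem universalOmega_eq_two_of_asymptoticRank_eq_zero (t : ι → κ → μ → K)
    (h0 : asymptoticRank t = 0) : universalOmega K t = 2 := by
  refine le_antisymm (universalOmega_le_of_qualifying K t ⟨le_rfl, by norm_num⟩ ?_)
    (two_le_universalOmega t)
  rw [h0]
  exact degenerationValue_nonneg K _ t

/-- **Alman 2021, Theorem 2.7, per qualifying `w` (exponent form)**: if `R̃(T) > 0`, `w ∈ [2,3]` and
`R̃(T) ≤ V_{w/3}(T)`, then `R̃(T)^{6/w − 2} ≤ S̃(T)`. From `asymptoticRank_le_of_qualifying`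
(`R̃ ≤ S̃^{w/6} R̃^{w/3}`): divide by `R̃^{w/3}` and raise to the power `6/w`. (For `T = 0` and
`w = 3` the exponent form would read `0^0 = 1 ≤ 0`, whence the hypothesis `R̃(T) > 0`.)
[cite: Alman2021, Thm. 2.7] -/
theorem rpow_le_asymptoticSliceRank_of_qualifying (t : ι → κ → μ → K)
    (hRpos : 0 < asymptoticRank t) {w : ℝ} (hw : w ∈ Set.Icc (2 : ℝ) 3)
    (hq : asymptoticRank t ≤ degenerationValue K (w / 3) t) :
    asymptoticRank t ^ (6 / w - 2) ≤ asymptoticSliceRank t := by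
  have h := asymptoticRank_le_of_qualifying K t hw hq
  have ht : t ≠ 0 := ne_zero_of_asymptoticRank_pos hRpos
  have hSpos : 0 < asymptoticSliceRank t :=
    zero_lt_one.trans_le (one_le_asymptoticSliceRank_of_ne_zero ht)
  have hw0 : 0 < w := by linarith [hw.1]
  have hw0' : w ≠ 0 := hw0.ne'
  -- `R̃^{1 - w/3} ≤ S̃^{w/6}`
  have h1 : asymptoticRank t ^ (1 - w / 3) ≤ asymptoticSliceRank t ^ (w / 6) := by
    rw [Real.rpow_sub hRpos, Real.rpow_one, div_le_iff₀ (Real.rpow_pos_of_pos hRpos _)]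
    exact h
  -- raise both sides to the power `6/w ≥ 0`
  have h2 := Real.rpow_le_rpow (Real.rpow_nonneg hRpos.le _) h1 (by positivity : (0 : ℝ) ≤ 6 / w)
  rw [← Real.rpow_mul hRpos.le, ← Real.rpow_mul hSpos.le] at h2
  have e1 : (1 - w / 3) * (6 / w) = 6 / w - 2 := by
    field_simp
    ring
  have e2 : w / 6 * (6 / w) = 1 := by
    field_simp
  rwa [e1, e2, Real.rpow_one] at h2

end Qualifying

/-! ## Theorem 2.7 -/

section Thm27

/-- **Alman 2021, Theorem 2.7** — DISCHARGE of the named fact `Alman2021_thm27`: for every tensor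
`T` (finite index types, any field), `R̃(T)^{6/ω_u(T) − 2} ≤ S̃(T)`. Cases: `R̃(T) = 0` (then
`ω_u(T) = 2`, exponent `1`); `ω_u(T) = 3` (exponent `0`, `1 ≤ S̃(T)` as `T ≠ 0`); `ω_u(T) < 3`:
`ω_u(T)` lies in the closure of the qualifying set, on which `w ↦ R̃^{6/w − 2} ≤ S̃`
(`rpow_le_asymptoticSliceRank_of_qualifying`), and this map is continuous at `ω_u(T) ≥ 2`.
[cite: Alman2021, Thm. 2.7] -/
theorem Alman2021_thm27_holds : Alman2021_thm27 := by
  intro K _ ι κ μ _ _ _ t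
  have hS0 : 0 ≤ asymptoticSliceRank t := asymptoticSliceRank_nonneg t
  rcases (asymptoticRank_nonneg t).eq_or_lt with hR0 | hRpos
  · -- `R̃ = 0`: `ω_u = 2`, exponent `1`, `0^1 = 0`
    rw [universalOmega_eq_two_of_asymptoticRank_eq_zero K t hR0.symm, ← hR0]
    have e : (6 : ℝ) / 2 - 2 = 1 := by norm_num
    rw [e, Real.rpow_one]
    exact hS0
  have ht : t ≠ 0 := ne_zero_of_asymptoticRank_pos hRpos
  have hS1 : 1 ≤ asymptoticSliceRank t := one_le_asymptoticSliceRank_of_ne_zero ht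
  have hw₀2 : 2 ≤ universalOmega K t := two_le_universalOmega t
  rcases (universalOmega_le_three t).eq_or_lt with h3 | hlt3
  · -- `ω_u = 3`: exponent `0`
    rw [h3]
    have e : (6 : ℝ) / 3 - 2 = 0 := by norm_num
    rw [e, Real.rpow_zero]
    exact hS1
  -- `ω_u < 3`: `ω_u` lies in the closure of the qualifying set `Q`
  set Q := {w : ℝ | w ∈ Set.Icc (2 : ℝ) 3 ∧ asymptoticRank t ≤ degenerationValue K (w / 3) t}
    with hQ
  have hdef : universalOmega K t = sInf (Q ∪ {3}) := rfl
  have hbdd : BddBelow (Q ∪ {3}) := by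
    refine ⟨2, ?_⟩
    rintro x (⟨⟨hx, _⟩, _⟩ | hx)
    · exact hx
    · rw [Set.mem_singleton_iff.1 hx]; norm_num
  have hmem : universalOmega K t ∈ closure Q := by
    have h1 : universalOmega K t ∈ closure (Q ∪ {3}) :=
      hdef ▸ csInf_mem_closure ⟨3, Set.mem_union_right _ rfl⟩ hbdd
    rw [closure_union, closure_singleton] at h1
    rcases h1 with h1 | h1
    · exact h1
    · exact absurd (Set.mem_singleton_iff.1 h1) hlt3.ne
  -- `w ↦ R̃^{6/w - 2}` is continuous at `ω_u ≥ 2` and `≤ S̃` on `Q`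
  have hle : ∀ w ∈ Q, asymptoticRank t ^ (6 / w - 2) ≤ asymptoticSliceRank t := fun w hw =>
    rpow_le_asymptoticSliceRank_of_qualifying K t hRpos hw.1 hw.2
  have hw₀0 : universalOmega K t ≠ 0 := by linarith
  have hexp : ContinuousAt (fun w : ℝ => 6 / w - 2) (universalOmega K t) :=
    (continuousAt_const.div continuousAt_id hw₀0).sub continuousAt_const
  have hcont : ContinuousAt (fun w : ℝ => asymptoticRank t ^ (6 / w - 2)) (universalOmega K t) :=
    (Real.continuousAt_const_rpow hRpos.ne').comp hexp
  haveI : (𝓝[Q] universalOmega K t).NeBot := mem_closure_iff_nhdsWithin_neBot.1 hmem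
  exact le_of_tendsto (hcont.continuousWithinAt (s := Q)).tendsto
    (eventually_nhdsWithin_of_forall hle)

end Thm27

end Literature.Barriers.MatrixMultiplication

end
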